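/-
Origin: expansion seat `planner-pub-hodgecm-mc-unitary-1-g5-0`, handover #2 r3 2026-08-19T15:45:01Z md5 7cd70477748c (88 l.; NEW additive leaf, RUN 36+; TERM form unitaryLineCharOfType / hasArchType_unitaryLineCharOfType / wmInputCM₂t / wmInputCM₂t_eq / wmOf₂t (binder-2 HypCensus interface); imports #1 + twin HodgeCM.Vendored.H21.NumberTheory.Automorphic.UnitaryLineCharacters — INSTALL ONLY WITH rows #3/#4 or K-1 v20 carrying the same targets) (`HOME/mc/pub-hodgecm-mc-unitary-1-g5/work/pkg/HodgeCM/Model/WmInstanceV2Term.lean`, md5 7cd70477, 88 lines);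
landed by the gen-12 packager (p-g12) in gate run 36 as `HodgeCM/Model/WmInstanceV2Term.lean` (stripped 2 trailing import-line comments).
-/
/-
Origin: speedrun cell pub-hodgecm, MODEL-CONSTRUCTION sub-cell, lineage mc-unitary-1 (node W2-Kn «K-norm», MODEL-DAG §1),
seat planner-pub-hodgecm-mc-unitary-1-g5-0 (gen 5), 2026-08-19.  Text = the TERM block of gen 4's full draft of record
(`HOME/mc/pub-hodgecm-mc-unitary-1-g4/work/pkg-draft/HodgeCM/Model/WmInstanceV2.lean` md5 6634507287bf, ll. 212–226; tree-side
shadow `…/work/shadow_v2_combined.lean` rc 0, no placeholder proof), split into its own leaf by gen 5 so that `WmInstanceV2.lean`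
never waits for the `UnitaryLineCharacters` twin.
Target in PKG: `HodgeCM/Model/WmInstanceV2Term.lean` (NEW additive leaf, RUN 36+; consumer: binder-2's `Model/HypCensus/*`).
INSTALL ONLY TOGETHER WITH (or after) the twins `HodgeCM/Vendored/H21/NumberTheory/Automorphic/UnitaryLineCharacters.lean` and its
one missing cone member `HodgeCM/Vendored/H21/NumberTheory/Automorphic/RelNormOneTorusInfPart.lean` (K-1 v20, glue-2 lineage — or the
byte-identical fallback rows of this seat's kit); every other import is in the package since RUN 35.
KERNEL only: 0 records / named facts, no placeholder proof; `Classical.choice` from a PROVED existence theorem = construction.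
CERTIFICATE: elaborated by this seat against the RUN-35 package oleans + the two twins compiled locally (no `lake` in PKG), rc 0,
`#print axioms HodgeCM.Model.wmInputCM₂t` ⊆ {propext, Classical.choice, Quot.sound} — log + cert under `HOME/mc/pub-hodgecm-mc-unitary-1-g5/farm/`.

WHAT THIS FILE IS.  The TERM form of the E-facing input record of `wm V c` v2 (K-norm):
  wmInputCM₂t V S hGR hρ nV nW hδ τ T hT := wmInputCM₂b V S hGR hρ (unitaryLineCharOfType nV) (unitaryLineCharOfType nW) hδ τ T hT
with `unitaryLineCharOfType m` = a `[U(1)]`-character of archimedean type `m`, CHOSEN ONCE from the tree existence theorem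
`Literature.NumberTheory.Automorphic.exists_unitaryLineChar_hasArchType` [WeilBNT1967 Ch. VII §3 lineage; kernel, trio], and its
spec `hasArchType_unitaryLineCharOfType`.  binder-2's census kit targets `wmInputCM₂t … (nVOf …) (nWOf …) hδ`; then the archimedean-type
binders `h∞V`/`h∞W` are `hasArchType_unitaryLineCharOfType _` (0 Prop binders at ∞).
-/
import Summits.HodgeConjecture.HodgeCM.Model.WmInstanceV2
import Literature.NumberTheory.Automorphic.UnitaryLineCharacters

-- G11b-3 recipe (port D30 slow-export class; ops-buildfix LEDGER B13-1/B13-3): elaborate sequentially so the trailing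
-- `attribute [implicit_reducible]` block (reducibilityCoreExt is keyed to the async environment branch) is in force at `.olean` export.
set_option Elab.async false

/-! PORT of `HodgeCM/Model/WmInstanceV2Term.lean` (HodgeCMPerL run 82) — verbatim mechanical port; provenance in the PORT header line. -/

noncomputable section

namespace HodgeCM.Model

open HodgeCM.Adelic Literature.NumberTheory.Weil1964 Literature.NumberTheory.Automorphic NumberField
open Literature.NumberTheory.GelbartRogawski1991.UnitaryDualPair
open Literature.RepresentationTheory.HeisenbergGroup
open scoped Matrix

variable {L : CMField} {ι₁ : L →+* ℂ}

section LineChar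

/-- **the `[U(1)]`-character of archimedean type `m`** ((χ′-final) preferred end state), chosen once from the tree
existence theorem `exists_unitaryLineChar_hasArchType` [WeilBNT1967 Ch. VII §3 lineage; kernel, trio]. -/
def unitaryLineCharOfType (m : NumberField.InfinitePlace (L : Type) → ℤ) :
    ContinuousMonoidHom (relNormOneIdeles (maximalRealSubfield (L : Type)) (L : Type) ⧸ relNormOneRat (maximalRealSubfield (L : Type)) (L : Type)) Circle :=
  (exists_unitaryLineChar_hasArchType (L : Type) m).choose

/-- its archimedean type is `m`. -/
theorem hasArchType_unitaryLineCharOfType (m : NumberField.InfinitePlace (L : Type) → ℤ) :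
    UnitaryLineChar.HasArchType (L : Type) (unitaryLineCharOfType (L := L) m) m :=
  (exists_unitaryLineChar_hasArchType (L : Type) m).choose_spec

end LineChar

section V2t

variable (hP : PrintFact_unitaryCompact) (V : HermSpace3 L ι₁) (S : StubTree.SeesawDatum L)

variable
  (hGR : (cmSplittingDatum (L : Type) finProdFinEquiv (frameD V) (frameD_real V) (frameD_ne V) (dW S) (dW_real S) (dW_ne S)).CompatibleSplitting)
  (hρ : HasThetaMajorants fun (p : CMAdelic (L : Type) (frameD V) × CMAdelic (L : Type) (dW S)) (Φ : CMSchwartz (L : Type) 6) =>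
      adelicMpCont.omega (↥(maximalRealSubfield L)) (Fin 6)
        (CMGram (L : Type) finProdFinEquiv (frameD V) (frameD_real V) (dW S) (dW_real S))
        (cmPairSplitting (L : Type) finProdFinEquiv (frameD V) (frameD_real V) (frameD_ne V) (dW S) (dW_real S) (dW_ne S) hGR p) Φ)

/-- **`wmInputCM` v2, TERM form**: `χV := unitaryLineCharOfType nV`, `χW := unitaryLineCharOfType nW` with the
type vectors `nV = Model.nVOf V S hGR …`, `nW = Model.nWOf V S hGR μ …` supplied by binder-2's census kit
(`Model/HypCensus/VacReadOff.lean`); then `h∞V`/`h∞W` are `hasArchType_unitaryLineCharOfType _`. -/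
def wmInputCM₂t (nV nW : NumberField.InfinitePlace (L : Type) → ℤ) (hδ : 0 < (ι₁ (imagUnit L)).im) (τ : L →+* ℂ)
    (T : GL (Fin 3) ℂ)
    (hT : formCongr (starRingEnd ℂ) T (V.Hm.map τ) = Literature.Geometry.ComplexHyperbolic.BallModel.J) : WmInput V S :=
  wmInputCM₂b V S hGR hρ (unitaryLineCharOfType (L := L) nV) (unitaryLineCharOfType (L := L) nW) hδ τ T hT

/-- the TERM form is the block of record at the chosen characters (definitional). -/
theorem wmInputCM₂t_eq (nV nW : NumberField.InfinitePlace (L : Type) → ℤ) (hδ : 0 < (ι₁ (imagUnit L)).im) (τ : L →+* ℂ)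
    (T : GL (Fin 3) ℂ) (hT : formCongr (starRingEnd ℂ) T (V.Hm.map τ) = Literature.Geometry.ComplexHyperbolic.BallModel.J) :
    wmInputCM₂t V S hGR hρ nV nW hδ τ T hT =
      wmInputCM₂b V S hGR hρ (unitaryLineCharOfType (L := L) nV) (unitaryLineCharOfType (L := L) nW) hδ τ T hT := rfl

/-- **`wm V c` v2, TERM form** = `wmOf' hP (wmInputCM₂t …)`. -/
def wmOf₂t (nV nW : NumberField.InfinitePlace (L : Type) → ℤ) (hδ : 0 < (ι₁ (imagUnit L)).im) (τ : L →+* ℂ)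
    (T : GL (Fin 3) ℂ)
    (hT : formCongr (starRingEnd ℂ) T (V.Hm.map τ) = Literature.Geometry.ComplexHyperbolic.BallModel.J) :
    WeilThetaModel (V.latticeModel hP).toQuotientModel.G (V.latticeModel hP).toQuotientModel.Γ
      (S.latticeModelW hP).toQuotientModel.G (S.latticeModelW hP).toQuotientModel.Γ :=
  wmOf' hP (wmInputCM₂t V S hGR hρ nV nW hδ τ T hT)

end V2t


end HodgeCM.Model

end
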